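import Literature.NumberTheory.ComplexMultiplication.RelativePairFlipKernel
import Literature.NumberTheory.ComplexMultiplication.PairFlipTransportDichotomy
import HarnessLib

/-!
# RELATIVE PAIR FLIPS, II: over a pair-flip slot that is a quotient of the partner slot the pair is additive UNLESS the
# partner type lies over the base type with constant unequal multiplicities — the converse of `ParallelShadowsSlots`

COR-CM (cell `pub-hodgecm2`, binder seat `b16` gen 52, count-neutral claim TOWER-SHADOW, file F2 — abstract `G`-set
level, families; theorems only, no definition, no named fact, no `sorry`).  NEW as stated, hence under `Summits/`.  HONEST
FRAMING: finite-dimensional linear algebra about the Kubota–Dodson rank of families of CM types; `HC_CM` is neither used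
nor asserted.

SETTING (F1 `RelativePairFlipKernel`, gen 49 `ParallelShadowsSlots`, gen 51 `PairFlipTransportDichotomy`): a two-slot
family `I = {i₀, i₁}` with base slot `X = E_{i₀}`, partner slot `Y = E_{i₁}`, CM types `Φ_i` for `ρ`, an equivariant
`r : E_{i₁} → E_{i₀}` and a relative pair flip at some `x₀`; `U(Φ_i) = antiSpan G (Φ i)`, `U(Σ) = antiSpan G (sigmaType Φ)`;
ADDITIVE means `ext_i U(Φ_i) ≤ U(Σ)` for both slots (`rank(Σ) + 2 = rank Φ_{i₀} + rank Φ_{i₁} + 1`,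
`Hg(A₀ × A₁) = Hg(A₀) × Hg(A₁)`).  Gen 49 proved: shadows PARALLEL (`u_1(Φ_{i₀}) = c · c₁`) ⟹ NOT additive (here
`typeRank_sigmaType_add_card_lt_of_parallel_self`, the base slot being its own quotient).  This file adds the converse:

* §1 **`forall_map_le_or_parallel_of_relFlip`**: `U(Φ_{i₀})` IRREDUCIBLE (e.g. a pair-flip slot), `G` transitive on both
  slots ⟹ the pair is ADDITIVE, OR the shadow of `Φ_{i₁}` on the base is `c⁻¹ u_1(Φ_{i₀})` (gen 51's Goursat dichotomy
  `additive_or_exists_collapse_of_irreducible` supplies the collapse map, F1 computes its kernel).  Hence the IFF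
  **`forall_map_le_iff_not_parallel_of_relFlip`**, rank form **`typeRank_sigmaType_add_card_eq_iff_of_relFlip`**,
  nondegeneracy form `typeRank_sigmaType_eq_iff_of_relFlip`.
* §2 THE EXACT CRITERION in Yanai's multiplicities (F1 `parallel_iff_exists_multiplicities`):
  **`typeRank_sigmaType_add_card_eq_iff_not_exists_multiplicities_of_relFlip`** — additive IFF `Φ_{i₁}` does NOT lie over
  `Φ_{i₀}` with constant multiplicities `(a, b)`, `a ≠ b`; **`typeRank_sigmaType_eq_iff_not_exists_multiplicities_of_relFlip`**
  — `Σ` nondegenerate IFF moreover `Φ_{i₁}` is; **`typeRank_sigmaType_eq_iff_of_forall_relFlip`** — relative flips at every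
  point and `r` surjective make the base a pair-flip slot, so no irreducibility hypothesis is left.
Number fields and abelian varieties: sequel `GenericCMSubfieldTowerHodge`.

## References

* [Gordon1999HodgeAVSurvey] B. B. Gordon, *A survey of the Hodge conjecture for abelian varieties*, §3 Theorem (Imai,
  Murty) with proof, 7.5–7.7 (Murty, Hazama), 9.4.3 (Yanai).
* [Serre1977] J.-P. Serre, *Linear Representations of Finite Groups*, GTM 42, §2.2, §7.2.
* [Dodson1984] B. Dodson, *The structure of Galois groups of CM-fields*, Trans. AMS 283 (1984), §1.1, §5.1.2.
* [Kubota1965] T. Kubota, *On the field extension by complex multiplication*, Trans. AMS 118 (1965), §2.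

Provenance: Literature home (namespace `Literature.NumberTheory.ComplexMultiplication.Shadow`) of the Summits-side `CorCM/RelativePairFlipShadows` (cell `pub-hodgecm2`, COR-CM; all its imports are `Literature/`, Mathlib and the already re-homed `RelativePairFlipKernel`, `PairFlipTransportDichotomy`), which `Literature/` may not import; theorems only, no named fact, no definition. Nothing here bears on `HC_CM`. Lane `lit-hodgefound` (Layer A3: CM types, their Kubota ranks and Galois combinatorics), seat p20.
-/

set_option autoImplicit false

noncomputable section

open scoped BigOperators

universe u v

namespace Literature.NumberTheory.ComplexMultiplication.Shadow

open Literature.NumberTheory.ComplexMultiplication.PointwiseConjugation Literature.NumberTheory.ComplexMultiplication.ReflexSlotRank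

open Literature.NumberTheory.ComplexMultiplication
open scoped Classical

variable {G : Type u} [Group G]

/-! ### §1 The dichotomy for families: additive, or parallel shadows -/

section Family

variable {I : Type v} {E : I → Type v} [∀ i, MulAction G (E i)] [DecidableEq I] [Fintype I] [∀ i, Fintype (E i)]
  {ρ : G} {Φ : ∀ i, Set (E i)} {i₀ i₁ : I}

/-- **Additive, or parallel shadows.**  `I = {i₀, i₁}`, `U(Φ_{i₀})` irreducible, `G` transitive on both slots,
`r : E_{i₁} → E_{i₀}` equivariant with a relative pair flip at `x₀`: EITHER both slot extensions lie in `U(Σ)` (the pair is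
additive, `Hg(A₀ × A₁) = Hg(A₀) × Hg(A₁)`) OR the shadow of `Φ_{i₁}` on `E_{i₀}` is `c⁻¹ · u_1(Φ_{i₀})`, `c ≠ 0`.
[cite: Gordon1999HodgeAVSurvey, §3 Theorem (proof) and 7.5–7.7] [cite: Serre1977, §2.2 and §7.2] -/
theorem forall_map_le_or_parallel_of_relFlip [MulAction.IsPretransitive G (E i₀)] [MulAction.IsPretransitive G (E i₁)]
    [Nonempty (E i₁)] (h : ∀ i, IsCMTypeWith ρ (Φ i)) (hI : ∀ j, j = i₀ ∨ j = i₁) (h01 : i₀ ≠ i₁)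
    (hirr : ∀ W : Submodule ℚ (E i₀ → ℚ), W ≤ antiSpan G (Φ i₀) → W ≠ ⊥ →
      (∀ (k : G) (f : E i₀ → ℚ), f ∈ W → (fun y => f (k • y)) ∈ W) → W = antiSpan G (Φ i₀))
    (r : E i₁ → E i₀) (hr : ∀ (g : G) (y : E i₁), r (g • y) = g • r y) {x₀ : E i₀}
    (hflip : ∃ σ : G, σ • x₀ = ρ • x₀ ∧ ∀ y : E i₁, r y ≠ x₀ → r y ≠ ρ • x₀ → σ • y = y) :
    (∀ i, (antiSpan G (Φ i)).map (slotExt i) ≤ antiSpan G (sigmaType Φ)) ∨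
      ∃ c : ℚ, c ≠ 0 ∧ ∀ x : E i₀, antiVec (Φ i₀) (1 : G) x =
        c * ∑ y ∈ Finset.univ.filter (fun y : E i₁ => r y = x), antiVec (Φ i₁) (1 : G) y := by
  rcases PairFlipTransport.additive_or_exists_collapse_of_irreducible hI h01 hirr with hadd | ⟨L, hL, -, hLu⟩
  · exact Or.inl hadd
  · exact Or.inr (antiVec_one_eq_mul_fibreSum_of_collapse (h i₀) (h i₁) r hr hflip L hL hLu)

variable [Nonempty I] [∀ i, Nonempty (E i)]

omit [DecidableEq I] in
/-- **Parallel shadows on the base slot make the rank non-additive** (gen 49's theorem with the base slot as its own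
quotient, `π₀ = id`): `rank(Σ) + |I| < Σ_i rank(Φ_i) + 1`. [cite: Gordon1999HodgeAVSurvey, §3 Theorem (proof), 7.5 and 9.4.3] -/
theorem typeRank_sigmaType_add_card_lt_of_parallel_self (h : ∀ i, IsCMTypeWith ρ (Φ i)) (h01 : i₀ ≠ i₁)
    (r : E i₁ → E i₀) (hr : ∀ (g : G) (y : E i₁), r (g • y) = g • r y) {c : ℚ}
    (hpar : ∀ x : E i₀, antiVec (Φ i₀) (1 : G) x =
      c * ∑ y ∈ Finset.univ.filter (fun y : E i₁ => r y = x), antiVec (Φ i₁) (1 : G) y) :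
    typeRank G (sigmaType Φ) + Fintype.card I < (∑ i, typeRank G (Φ i)) + 1 := by
  classical
  obtain ⟨x₀⟩ := ‹∀ i, Nonempty (E i)› i₀
  have hself : ∀ z : E i₀,
      ∑ x ∈ Finset.univ.filter (fun x : E i₀ => (fun t : E i₀ => t) x = z), antiVec (Φ i₀) (1 : G) x =
        antiVec (Φ i₀) (1 : G) z := fun z => by
    have hs : Finset.univ.filter (fun x : E i₀ => (fun t : E i₀ => t) x = z) = {z} := by
      ext x
      simp only [Finset.mem_filter, Finset.mem_univ, true_and, Finset.mem_singleton]
    rw [hs, Finset.sum_singleton]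
  refine typeRank_sigmaType_add_card_lt_of_parallel_fibreSum h h01 (fun t : E i₀ => t) r (fun _ _ => rfl) hr c
    (fun z => ?_) (z₀ := x₀) ?_
  · rw [hself]
    exact hpar z
  · rw [hself]
    exact antiVec_ne_zero (Φ i₀) (1 : G) x₀

/-- **Additive IFF the shadows are not parallel** (relative pair flip at `x₀`, `U(Φ_{i₀})` irreducible, `I = {i₀, i₁}`).
[cite: Gordon1999HodgeAVSurvey, §3 Theorem and 7.5–7.7, 9.4.3] -/
theorem forall_map_le_iff_not_parallel_of_relFlip [MulAction.IsPretransitive G (E i₀)]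
    [MulAction.IsPretransitive G (E i₁)] (h : ∀ i, IsCMTypeWith ρ (Φ i)) (hI : ∀ j, j = i₀ ∨ j = i₁) (h01 : i₀ ≠ i₁)
    (hirr : ∀ W : Submodule ℚ (E i₀ → ℚ), W ≤ antiSpan G (Φ i₀) → W ≠ ⊥ →
      (∀ (k : G) (f : E i₀ → ℚ), f ∈ W → (fun y => f (k • y)) ∈ W) → W = antiSpan G (Φ i₀))
    (r : E i₁ → E i₀) (hr : ∀ (g : G) (y : E i₁), r (g • y) = g • r y) {x₀ : E i₀}
    (hflip : ∃ σ : G, σ • x₀ = ρ • x₀ ∧ ∀ y : E i₁, r y ≠ x₀ → r y ≠ ρ • x₀ → σ • y = y) :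
    (∀ i, (antiSpan G (Φ i)).map (slotExt i) ≤ antiSpan G (sigmaType Φ)) ↔
      ¬ ∃ c : ℚ, ∀ x : E i₀, antiVec (Φ i₀) (1 : G) x =
        c * ∑ y ∈ Finset.univ.filter (fun y : E i₁ => r y = x), antiVec (Φ i₁) (1 : G) y := by
  constructor
  · rintro hadd ⟨c, hc⟩
    have h1 := typeRank_sigmaType_add_card_eq_of_forall_map_le h hadd
    have h2 := typeRank_sigmaType_add_card_lt_of_parallel_self h h01 r hr hc
    omega
  · intro hnot
    rcases forall_map_le_or_parallel_of_relFlip h hI h01 hirr r hr hflip with hadd | ⟨c, -, hc⟩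
    · exact hadd
    · exact absurd ⟨c, hc⟩ hnot

/-- **Rank form**: `rank(Σ) + |I| = Σ_i rank(Φ_i) + 1` (`Hg(A₀ × A₁) = Hg(A₀) × Hg(A₁)`) IFF the shadow of `Φ_{i₁}` on the
base slot is not a multiple of `u_1(Φ_{i₀})`. [cite: Gordon1999HodgeAVSurvey, §3 Theorem (1), 7.5–7.7 and 9.4.3] -/
theorem typeRank_sigmaType_add_card_eq_iff_of_relFlip [MulAction.IsPretransitive G (E i₀)]
    [MulAction.IsPretransitive G (E i₁)] (h : ∀ i, IsCMTypeWith ρ (Φ i)) (hI : ∀ j, j = i₀ ∨ j = i₁) (h01 : i₀ ≠ i₁)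
    (hirr : ∀ W : Submodule ℚ (E i₀ → ℚ), W ≤ antiSpan G (Φ i₀) → W ≠ ⊥ →
      (∀ (k : G) (f : E i₀ → ℚ), f ∈ W → (fun y => f (k • y)) ∈ W) → W = antiSpan G (Φ i₀))
    (r : E i₁ → E i₀) (hr : ∀ (g : G) (y : E i₁), r (g • y) = g • r y) {x₀ : E i₀}
    (hflip : ∃ σ : G, σ • x₀ = ρ • x₀ ∧ ∀ y : E i₁, r y ≠ x₀ → r y ≠ ρ • x₀ → σ • y = y) :
    typeRank G (sigmaType Φ) + Fintype.card I = (∑ i, typeRank G (Φ i)) + 1 ↔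
      ¬ ∃ c : ℚ, ∀ x : E i₀, antiVec (Φ i₀) (1 : G) x =
        c * ∑ y ∈ Finset.univ.filter (fun y : E i₁ => r y = x), antiVec (Φ i₁) (1 : G) y := by
  constructor
  · rintro heq ⟨c, hc⟩
    have h2 := typeRank_sigmaType_add_card_lt_of_parallel_self h h01 r hr hc
    omega
  · intro hnot
    exact typeRank_sigmaType_add_card_eq_of_forall_map_le h
      ((forall_map_le_iff_not_parallel_of_relFlip h hI h01 hirr r hr hflip).2 hnot)

/-- **Nondegeneracy form**: with `Φ_{i₀}` nondegenerate, `Σ` is nondegenerate IFF `Φ_{i₁}` is nondegenerate AND its shadow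
on the base slot is not a multiple of `u_1(Φ_{i₀})`. [cite: Gordon1999HodgeAVSurvey, 7.5–7.7 and 9.4.3] -/
theorem typeRank_sigmaType_eq_iff_of_relFlip [MulAction.IsPretransitive G (E i₀)]
    [MulAction.IsPretransitive G (E i₁)] (h : ∀ i, IsCMTypeWith ρ (Φ i)) (hI : ∀ j, j = i₀ ∨ j = i₁) (h01 : i₀ ≠ i₁)
    (hirr : ∀ W : Submodule ℚ (E i₀ → ℚ), W ≤ antiSpan G (Φ i₀) → W ≠ ⊥ →
      (∀ (k : G) (f : E i₀ → ℚ), f ∈ W → (fun y => f (k • y)) ∈ W) → W = antiSpan G (Φ i₀))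
    (hnd₀ : typeRank G (Φ i₀) = Fintype.card (E i₀) / 2 + 1)
    (r : E i₁ → E i₀) (hr : ∀ (g : G) (y : E i₁), r (g • y) = g • r y) {x₀ : E i₀}
    (hflip : ∃ σ : G, σ • x₀ = ρ • x₀ ∧ ∀ y : E i₁, r y ≠ x₀ → r y ≠ ρ • x₀ → σ • y = y) :
    typeRank G (sigmaType Φ) = Fintype.card (Σ i, E i) / 2 + 1 ↔
      typeRank G (Φ i₁) = Fintype.card (E i₁) / 2 + 1 ∧
        ¬ ∃ c : ℚ, ∀ x : E i₀, antiVec (Φ i₀) (1 : G) x =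
          c * ∑ y ∈ Finset.univ.filter (fun y : E i₁ => r y = x), antiVec (Φ i₁) (1 : G) y := by
  constructor
  · intro hnd
    refine ⟨typeRank_eq_of_typeRank_sigmaType_eq h hnd i₁, fun ⟨c, hc⟩ => ?_⟩
    have h1 := typeRank_sigmaType_add_card_eq_of_forall_map_le h
      (forall_map_slotExt_le_of_typeRank_sigmaType_eq h hnd)
    have h2 := typeRank_sigmaType_add_card_lt_of_parallel_self h h01 r hr hc
    omega
  · rintro ⟨hnd₁, hnot⟩
    rw [typeRank_sigmaType_eq_iff_forall_of_forall_map_le h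
      ((forall_map_le_iff_not_parallel_of_relFlip h hI h01 hirr r hr hflip).2 hnot)]
    intro i
    rcases hI i with rfl | rfl
    · exact hnd₀
    · exact hnd₁

/-! ### §2 The exact criterion in Yanai's multiplicities -/

/-- **THE EXACT CRITERION (rank form).**  `I = {i₀, i₁}`, `U(Φ_{i₀})` irreducible, `G` transitive on both slots,
`r : E_{i₁} → E_{i₀}` equivariant with a relative pair flip: `rank(Σ) + 2 = rank Φ_{i₀} + rank Φ_{i₁} + 1`
(`Hg(A₀ × A₁) = Hg(A₀) × Hg(A₁)`) IFF `Φ_{i₁}` does NOT lie over `Φ_{i₀}` with constant multiplicities `(a, b)`, `a ≠ b`.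
[cite: Gordon1999HodgeAVSurvey, §3 Theorem (1), 7.5–7.7 and 9.4.3] -/
theorem typeRank_sigmaType_add_card_eq_iff_not_exists_multiplicities_of_relFlip [MulAction.IsPretransitive G (E i₀)]
    [MulAction.IsPretransitive G (E i₁)] (h : ∀ i, IsCMTypeWith ρ (Φ i)) (hI : ∀ j, j = i₀ ∨ j = i₁) (h01 : i₀ ≠ i₁)
    (hirr : ∀ W : Submodule ℚ (E i₀ → ℚ), W ≤ antiSpan G (Φ i₀) → W ≠ ⊥ →
      (∀ (k : G) (f : E i₀ → ℚ), f ∈ W → (fun y => f (k • y)) ∈ W) → W = antiSpan G (Φ i₀))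
    (r : E i₁ → E i₀) (hr : ∀ (g : G) (y : E i₁), r (g • y) = g • r y) {x₀ : E i₀}
    (hflip : ∃ σ : G, σ • x₀ = ρ • x₀ ∧ ∀ y : E i₁, r y ≠ x₀ → r y ≠ ρ • x₀ → σ • y = y) :
    typeRank G (sigmaType Φ) + Fintype.card I = (∑ i, typeRank G (Φ i)) + 1 ↔
      ¬ ∃ a b : ℕ, a ≠ b ∧ ∀ x : E i₀,
        (Finset.univ.filter fun y : E i₁ => r y = x ∧ y ∈ Φ i₁).card = if x ∈ Φ i₀ then a else b := by
  rw [typeRank_sigmaType_add_card_eq_iff_of_relFlip h hI h01 hirr r hr hflip,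
    parallel_iff_exists_multiplicities (h i₀) (h i₁) r hr]

/-- **THE EXACT CRITERION (nondegeneracy form).**  With `Φ_{i₀}` nondegenerate: `Σ` is nondegenerate IFF `Φ_{i₁}` is
nondegenerate AND does not lie over `Φ_{i₀}` with constant multiplicities `(a, b)`, `a ≠ b`.
[cite: Gordon1999HodgeAVSurvey, 7.5–7.7 and 9.4.3] -/
theorem typeRank_sigmaType_eq_iff_not_exists_multiplicities_of_relFlip [MulAction.IsPretransitive G (E i₀)]
    [MulAction.IsPretransitive G (E i₁)] (h : ∀ i, IsCMTypeWith ρ (Φ i)) (hI : ∀ j, j = i₀ ∨ j = i₁) (h01 : i₀ ≠ i₁)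
    (hirr : ∀ W : Submodule ℚ (E i₀ → ℚ), W ≤ antiSpan G (Φ i₀) → W ≠ ⊥ →
      (∀ (k : G) (f : E i₀ → ℚ), f ∈ W → (fun y => f (k • y)) ∈ W) → W = antiSpan G (Φ i₀))
    (hnd₀ : typeRank G (Φ i₀) = Fintype.card (E i₀) / 2 + 1)
    (r : E i₁ → E i₀) (hr : ∀ (g : G) (y : E i₁), r (g • y) = g • r y) {x₀ : E i₀}
    (hflip : ∃ σ : G, σ • x₀ = ρ • x₀ ∧ ∀ y : E i₁, r y ≠ x₀ → r y ≠ ρ • x₀ → σ • y = y) :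
    typeRank G (sigmaType Φ) = Fintype.card (Σ i, E i) / 2 + 1 ↔
      typeRank G (Φ i₁) = Fintype.card (E i₁) / 2 + 1 ∧
        ¬ ∃ a b : ℕ, a ≠ b ∧ ∀ x : E i₀,
          (Finset.univ.filter fun y : E i₁ => r y = x ∧ y ∈ Φ i₁).card = if x ∈ Φ i₀ then a else b := by
  rw [typeRank_sigmaType_eq_iff_of_relFlip h hI h01 hirr hnd₀ r hr hflip,
    parallel_iff_exists_multiplicities (h i₀) (h i₁) r hr]

/-- **Pair-flip base, relative flips everywhere.**  If `r` is surjective and EVERY point of the base carries a relative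
pair flip, then `U(Φ_{i₀})` is irreducible and `Φ_{i₀}` nondegenerate automatically (`pairFlip_of_relFlip`,
`antiSpan_irreducible_of_pairFlip`, `typeRank_eq_of_pairFlip`): `Σ` is nondegenerate IFF `Φ_{i₁}` is nondegenerate and
does not lie over `Φ_{i₀}` with constant unequal multiplicities. [cite: Dodson1984, §5.1.2]
[cite: Gordon1999HodgeAVSurvey, 7.5–7.7 and 9.4.3] -/
theorem typeRank_sigmaType_eq_iff_of_forall_relFlip [MulAction.IsPretransitive G (E i₀)]
    [MulAction.IsPretransitive G (E i₁)] (h : ∀ i, IsCMTypeWith ρ (Φ i)) (hI : ∀ j, j = i₀ ∨ j = i₁) (h01 : i₀ ≠ i₁)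
    (r : E i₁ → E i₀) (hr : ∀ (g : G) (y : E i₁), r (g • y) = g • r y) (hsurj : Function.Surjective r)
    (hflip : ∀ x : E i₀, ∃ σ : G, σ • x = ρ • x ∧ ∀ y : E i₁, r y ≠ x → r y ≠ ρ • x → σ • y = y) :
    typeRank G (sigmaType Φ) = Fintype.card (Σ i, E i) / 2 + 1 ↔
      typeRank G (Φ i₁) = Fintype.card (E i₁) / 2 + 1 ∧
        ¬ ∃ a b : ℕ, a ≠ b ∧ ∀ x : E i₀,
          (Finset.univ.filter fun y : E i₁ => r y = x ∧ y ∈ Φ i₁).card = if x ∈ Φ i₀ then a else b := by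
  obtain ⟨x₀⟩ := ‹∀ i, Nonempty (E i)› i₀
  have hpf := pairFlip_of_relFlip r hr hsurj hflip
  exact typeRank_sigmaType_eq_iff_not_exists_multiplicities_of_relFlip h hI h01
    (antiSpan_irreducible_of_pairFlip (h i₀) hpf) (typeRank_eq_of_pairFlip (h i₀) hpf) r hr (hflip x₀)

end Family

end Literature.NumberTheory.ComplexMultiplication.Shadow

end
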